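import Summits.QuantumFields.YangMills.Theorems.LangevinControlUVFemtoCurvatureTwoPointReductionLimits
import Summits.QuantumFields.YangMills.Theorems.LangevinControlUVFemtoCurvatureTwoPointStubVarianceEvenOfChessboardDoubling
import Summits.QuantumFields.YangMills.Theorems.LangevinControlUVFemtoCurvatureTwoPointChessboardEvenOfRPCS
import Summits.QuantumFields.YangMills.Theorems.LangevinControlUVFemtoCurvatureTwoPointStubPlaquetteProductRPCS
import Summits.QuantumFields.YangMills.Theorems.LangevinControlUVFemtoCurvatureTwoPointStubDoublingOfRV
import Literature.MathematicalPhysics.QuantumFieldTheory.WilsonPartitionRegularVariation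

/-!
# Route `LangevinControlUV`, item `FemtoCurvatureTwoPoint` (stmt-QuantumFields-9363), line `generic-step-gamma-encoding`:
# core assembly — the item from the named fact RV and the open core GD-dom ∧ REST-odd

Support file (`--supports stmt-QuantumFields-9363`). Assembles the LANDED even-torus variance route of the line
(`stub_plaquetteProductRPCS` p116798 ⇒ `stub_chessboardEven_of_RPCS` p114602 ⇒ with `stub_doubling_of_RV` p114599 ⇒
`stub_varianceEven_of_chessboard_doubling` p115461) into the statements of `…TwoPointDefsDU`, and composes with
`femtoCurvatureTwoPoint_of_parts` (`…TwoPointReductionLimits`):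

* `plaquetteChessboardEven_holds : PlaquetteChessboardEven` — the chessboard estimate for the `01`-plaquette field on every
  even torus, unconditional (reflection positivity in all four directions);
* `fixedTorusDoubling_of_RV : WilsonPartitionRegularVariation → FixedTorusDoubling` and
  `plaquetteVarianceEven_of_RV : WilsonPartitionRegularVariation → PlaquetteVarianceEven` — `β² Var P ≤ C` on every even torus,
  `β ≥ B(L)`, ONE `C`, modulo the Literature named fact RV (Arnold–Gusein-Zade–Varchenko II Thm 7.6 / Watanabe 2009 Thm 7.1(1):
  regular variation of the fixed-torus Wilson partition function at `β = ∞`);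
* **`femtoCurvatureTwoPoint_of_core : WilsonPartitionRegularVariation → AxisGaussianDomination → DiagUpperRestOdd →
  FemtoCurvatureTwoPoint`** — the typed item modulo RV and the ONE open core (fixed-torus Gaussian domination from below on the
  axis, GD-dom; variance on odd tori and the two `dist⁸`-weighted profiles, REST-odd: toron-aware fixed-torus second-order
  Laplace asymptotics with `L`-uniform constants).

Together with `femtoCurvatureTwoPoint_of_limits` (`…TwoPointReductionLimits`) these are the two by-name promotable entry
points recorded on the item (lead c2 report; this file is their landing).
-/

set_option autoImplicit false

noncomputable section

open scoped BigOperators Matrix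
open MeasureTheory Filter Topology ProbabilityTheory

namespace Summit.QuantumFields.YangMills.Cruxes.FemtoCurvatureTwoPoint.GenericStepGammaEncoding

open Literature.MathematicalPhysics.QuantumFieldTheory
open Summit.QuantumFields.YangMills.Theorems.FemtoCurvatureTwoPoint (stub_plaquetteProductRPCS
  stub_chessboardEven_of_RPCS stub_doubling_of_RV stub_varianceEven_of_chessboard_doubling)

/-- **CHESS-even holds**: the chessboard estimate for the `01`-plaquette field on every even torus (statement
`PlaquetteChessboardEven` of `…TwoPointDefsDU`), from the landed reflection Cauchy–Schwarz for plaquette products (RPCS) and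
the landed abstract even chessboard estimate. -/
theorem plaquetteChessboardEven_holds : PlaquetteChessboardEven :=
  stub_chessboardEven_of_RPCS stub_plaquetteProductRPCS

/-- **DBL from RV**: regular variation of `Z_L` at `β = ∞` gives the doubling `Z_L(β/2) ≤ e^{AL⁴} Z_L(β)` for `β ≥ B(L)`
with one `A` (statement `FixedTorusDoubling` of `…TwoPointDefsDU`; the landed `stub_doubling_of_RV`). -/
theorem fixedTorusDoubling_of_RV (hRV : WilsonPartitionRegularVariation) : FixedTorusDoubling :=
  stub_doubling_of_RV hRV

/-- **VAR-even from RV**: `β² · |⟨P²⟩ − ⟨P⟩²| ≤ C` on every EVEN torus for `β ≥ B(L)`, one `C` for all tori, modulo the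
named fact RV (chessboard + AM–GM + `Z`-doubling; the landed `stub_varianceEven_of_chessboard_doubling`). -/
theorem plaquetteVarianceEven_of_RV (hRV : WilsonPartitionRegularVariation) : PlaquetteVarianceEven :=
  stub_varianceEven_of_chessboard_doubling plaquetteChessboardEven_holds (fixedTorusDoubling_of_RV hRV)

/-- **The item modulo RV and the open core** (`femtoCurvatureTwoPoint_of_core`): `WilsonPartitionRegularVariation →
AxisGaussianDomination → DiagUpperRestOdd → FemtoCurvatureTwoPoint`. -/
theorem femtoCurvatureTwoPoint_of_core : WilsonPartitionRegularVariation → AxisGaussianDomination → DiagUpperRestOdd → Summit.QuantumFields.YangMills.Theses.LangevinControlUV.FemtoCurvatureTwoPoint :=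
  fun hRV hD hR => femtoCurvatureTwoPoint_of_parts hD (plaquetteVarianceEven_of_RV hRV) hR

end Summit.QuantumFields.YangMills.Cruxes.FemtoCurvatureTwoPoint.GenericStepGammaEncoding

end
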